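import Literature.Probability.Percolation.BondInterfaceFaceDomainULC
import Literature.Probability.LatticeModels.MeshDomainJordan
import HarnessLib

/-!
# A vertex of the piece near a boundary point (stub of line `face-kernel-k1`)

For a closed piece `bloop i m hm hcl` of the left-hand boundary walk `E.bwalk d₀` of the union of
inner faces of a discrete Dobrushin datum `E` on a domain `Ω` that is open, with connected
unbounded exterior `(closure Ω)ᶜ` whose closure contains `∂Ω`: if a point `p` within distance `r`
of a boundary point `b` lies in a lattice face of non-zero winding number, then some vertex of
the piece is within `r + δ` of `b`.

Proof (by contradiction): if all vertices of the piece are at distance `≥ r + δ` from `b`, every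
point of the scaled polygon (at distance `≤ δ` from a vertex) is at distance `≥ r` from `b`, so
the ball `ball b r` misses the polygon. The ball contains `p` and (as `b ∈ closure (closure Ω)ᶜ`)
an exterior point `b''`; the exterior is open, connected (hence path-connected), unbounded, and
misses the polygon (which lies in `closure Ω`). So `p` is joined off the polygon to exterior
points of arbitrarily large norm; descaling by `δ⁻¹`, the winding number `W ∘ flFace` is constant
along the path (`ClosedWalk.W_flFace_eq_of_joinedIn`) and vanishes far away
(`ClosedWalk.exists_W_flFace_eq_zero`), contradicting `W ≠ 0`.
-/

noncomputable section

open scoped Topology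
open Filter Set Metric
open Literature.Probability Literature.Probability.LatticeModels Literature.Probability.Percolation
open Literature.Probability.LatticeModels.DiscreteDobrushin Literature.Probability.LatticeModels.Mesh
open Literature.Probability.RandomPlanarGeometry

namespace Summit.CriticalPhenomena.CardyFormulaZ2.Cruxes.ParafermionToSLESixFamilies.FaceKernel

/-- The mesh points of a site and of its neighbour in direction `k` are at distance `δ`. -/
private theorem dist_meshPoint_add_cornerUnit_vertexNear {δ : ℝ} (hδ : 0 < δ) (v : Site 2)
    (k : Fin 4) : dist (meshPoint δ (v + cornerUnit k)) (meshPoint δ v) = δ := by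
  rw [Complex.dist_eq, Complex.norm_eq_sqrt_sq_add_sq]
  simp only [Complex.sub_re, Complex.sub_im, meshPoint_re, meshPoint_im, Pi.add_apply, Int.cast_add]
  fin_cases k <;> simp [cornerUnit] <;> (ring_nf; exact Real.sqrt_sq hδ.le)

/-- **A vertex of the piece near a boundary point.** For a closed piece `bloop i m hm hcl` of the
boundary walk `E.bwalk d₀` (started at a face-boundary dart `d₀`) of a discrete Dobrushin datum
`E` on an open domain `Ω` with connected, unbounded exterior `(closure Ω)ᶜ` whose closure contains
`∂Ω`: if a point `p` within distance `r` of a boundary point `b` lies in a lattice face of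
non-zero winding number of the piece, then some vertex of the piece is within `r + δ` of `b`. -/
theorem stub_exists_vertex_near :
    ∀ (E : DiscreteDobrushin), 0 < E.δ → IsOpen E.Ω → IsConnected (closure E.Ω)ᶜ →
      ¬ Bornology.IsBounded (closure E.Ω)ᶜ → frontier E.Ω ⊆ closure (closure E.Ω)ᶜ →
      ∀ (d₀ : Site 2 × Fin 4), E.IsOutEdge d₀.1 d₀.2 →
      ∀ (i m : ℕ) (hm : 0 < m) (hcl : (E.bwalk d₀ (i + m)).1 = (E.bwalk d₀ i).1)
        (p b : ℂ) (r : ℝ), b ∈ frontier E.Ω → dist p b < r →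
        (bloop i m hm hcl).W (flFace ((E.δ : ℂ)⁻¹ * p)) ≠ 0 →
        ∃ t < m, dist (meshPoint E.δ (E.bwalk d₀ (i + t)).1) b < r + E.δ := by
  intro E hδ _hΩo hext hunb hfr d₀ h₀ i m hm hcl p b r hb hpb hW
  by_contra! h
  have hδ0 : (E.δ : ℂ) ≠ 0 := by exact_mod_cast hδ.ne'
  have hr : 0 < r := dist_nonneg.trans_lt hpb
  -- (1) the ball `ball b r` misses the scaled polygon: a point of the polygon lies on the scaled
  -- segment of an out-dart, at distance `≤ δ` from its source vertex
  have hball : ball b r ⊆ ((bloop i m hm hcl).strace E.δ)ᶜ := by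
    intro x hx hxs
    obtain ⟨t, -, ht⟩ := (bloop i m hm hcl).mem_strace_iff.1 hxs
    rw [bloop_v, bloop_v_succ, ← meshPoint_eq_mul_latC, ← meshPoint_eq_mul_latC] at ht
    have hxq : dist x (meshPoint E.δ (E.bwalk d₀ (i + t % m)).1) ≤ E.δ :=
      (dist_left_le_of_mem_segment ht).trans_eq (dist_meshPoint_add_cornerUnit_vertexNear hδ _ _)
    have hq : r + E.δ ≤ dist (meshPoint E.δ (E.bwalk d₀ (i + t % m)).1) b :=
      h (t % m) (Nat.mod_lt _ hm)
    have htri := dist_triangle (meshPoint E.δ (E.bwalk d₀ (i + t % m)).1) x b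
    have hxb : dist x b < r := mem_ball.1 hx
    rw [dist_comm] at hxq
    linarith
  -- (2) an exterior point in the ball
  obtain ⟨b'', hb''E, hbb''⟩ := Metric.mem_closure_iff.1 (hfr hb) r hr
  -- (3) join `p` to `b''` inside the (convex) ball, hence off the polygon
  have hpball : p ∈ ball b r := mem_ball.2 hpb
  have hb''ball : b'' ∈ ball b r := by rw [mem_ball, dist_comm]; exact hbb''
  have hj1 : JoinedIn ((bloop i m hm hcl).strace E.δ)ᶜ p b'' :=
    (((convex_ball b r).isPathConnected ⟨p, hpball⟩).joinedIn p hpball b'' hb''ball).mono hball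
  -- (4) the exterior is open and connected, hence path-connected; it misses the polygon and is
  -- unbounded
  have hVo : IsOpen (closure E.Ω)ᶜ := isClosed_closure.isOpen_compl
  have hVpc : IsPathConnected (closure E.Ω)ᶜ := (hVo.isConnected_iff_isPathConnected).1 hext
  have hVsub : (closure E.Ω)ᶜ ⊆ ((bloop i m hm hcl).strace E.δ)ᶜ :=
    Set.compl_subset_compl.2 (strace_bloop_subset h₀)
  obtain ⟨R, hR⟩ := (bloop i m hm hcl).exists_W_flFace_eq_zero hm
  obtain ⟨w, hwE, hwR⟩ : ∃ w ∈ (closure E.Ω)ᶜ, E.δ * |R| < ‖w‖ := by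
    by_contra! h'
    exact hunb ((Metric.isBounded_closedBall (x := (0 : ℂ)) (r := E.δ * |R|)).subset fun w hw => by
      simpa using h' w hw)
  have hj2 : JoinedIn ((bloop i m hm hcl).strace E.δ)ᶜ b'' w :=
    (hVpc.joinedIn b'' hb''E w hwE).mono hVsub
  have hj : JoinedIn ((bloop i m hm hcl).strace E.δ)ᶜ p w := hj1.trans hj2
  -- (5) descale by `δ⁻¹`
  have hj' : JoinedIn (bloop i m hm hcl).traceᶜ ((E.δ : ℂ)⁻¹ * p) ((E.δ : ℂ)⁻¹ * w) := by
    have h := hj.map (f := fun z : ℂ => (E.δ : ℂ)⁻¹ * z) (continuous_const.mul continuous_id)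
    refine h.mono ?_
    rintro _ ⟨u, hu, rfl⟩ hut
    refine hu ⟨(E.δ : ℂ)⁻¹ * u, hut, ?_⟩
    simp only [← mul_assoc, mul_inv_cancel₀ hδ0, one_mul]
  -- (6) the winding number is constant along the path and vanishes far away
  apply hW
  rw [(bloop i m hm hcl).W_flFace_eq_of_joinedIn hm hj']
  refine hR _ ?_
  rw [norm_mul, norm_inv, Complex.norm_real, Real.norm_of_nonneg hδ.le, inv_mul_eq_div,
    lt_div_iff₀ hδ]
  calc R * E.δ ≤ |R| * E.δ := mul_le_mul_of_nonneg_right (le_abs_self R) hδ.le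
    _ = E.δ * |R| := mul_comm _ _
    _ < ‖w‖ := hwR

end Summit.CriticalPhenomena.CardyFormulaZ2.Cruxes.ParafermionToSLESixFamilies.FaceKernel

end
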